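import Summits.QuantumFields.YangMills.Theorems.PoincareLipschitzMinimisingMapCompactnessEnergy
import HarnessLib

/-!
# Crux `BlockLipschitzL` (stmt-QuantumFields-23533) ∕ `HistoryTailL` (stmt-QuantumFields-19936), LINE 25 «CompactnessTransfer»,
# (C)-PROOF brick (C-e2) «THE LIMIT OF A MINIMISING SEQUENCE INTO `S³` IS BALL-MINIMISING»

Cell `ym3-torus` (YM ladder rung R3 = continuum SU(2) Yang–Mills on T³ — a RUNG, NOT the Clay problem: not d = 4, not
infinite volume, not a mass gap); WIDTH helper seat `ym-ust-19936-w2` g13, (C)-PROOF lineage project (LEAD GO 13:49Z):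
`MinimisingMapCompactness_holds` by Hardt–Kinderlehrer–Lin.  Helper `--supports stmt-QuantumFields-23533`; THEOREMS ONLY
(0 `def`, 0 `sorry`; ONE decl-local `maxHeartbeats 400000` with its `-- hb:` reason line, README №24 (a)).  Imports: (C-e1) ✓`…MinimisingMapCompactnessEnergy` (w2) and through it (C-a3),
(C-d) D1 (px16 g9), (C-d0) (px14 g6), the (C-e) letters.

WHAT THIS FILE DOES (Simon 1996 §2.9 Lemma 1, second half: «the limit minimises»).  Same data as (C-e1) plus ENERGY
CONVERGENCE on every ball `closedBall y ρ ⊆ Q` (the conclusion of (C-e1), taken as the row `hE`).  CONDITIONAL on the HKL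
shell-competitor socket `hHKL` (constant `K`): the limit `U` minimises on every ball `closedBall y ρ ⊆ Q` against unit
finite-energy competitors `W` agreeing with `U` off a smaller concentric ball (★★★ `ballMinimal_limit`).  Proof: `W = U` off
`ball y ρ′`, `ρ′ < ρ`; put `ρ₀ := max ρ′ (ρ/2)`, `σ := (ρ₀+ρ)/2`; for `N` shells of width `(ρ−σ)/N` in `(σ,ρ)` pick one
carrying `≤ E(U,Q)/N` of `U`'s energy (px14); the socket with inner map `V := W` and outer map `u_j` gives competitors `W_j`
for `u_j` (`= W` on `B_{ρ₁}`, `= u_j` off `B_{ρ₂}`); D1 (px16) against `u_j`'s minimality on `B_{ρ+δ/2}`: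
`E(u_j,B_{ρ₂}) ≤ E(W,B_{ρ₁}) + K(E(W,shell) + E(u_j,shell) + h⁻²∫_shell‖W−u_j‖²)`; on the shell `W = U` pointwise and
`dens GW = dens G` a.e. (px16 locality ✓`dens_ae_eq_off_ball`); let `j → ∞` with `hE` on `B_{ρ₁}, B_{ρ₂}` and `L²`:
`E(U,B_{ρ₂}) ≤ E(W,B_{ρ₁}) + 2K·E(U,shell) ≤ E(W,B_{ρ₁}) + 2K·E(U,Q)/N`; add `E(U,B_ρ∖B_{ρ₂}) = E(W,B_ρ∖B_{ρ₂})`: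
`E(U,B_ρ) ≤ E(W,B_ρ) + 2K·E(U,Q)/N` for every `N`.

HONEST SCOPE.  Conditional on the (C-bc) socket (HYPOTHESIS `hHKL`; discharged in the knit by w4 g15's (C-bc) file); nothing
of (C), (RS), S1″, S2♭″, `BlockLipschitzL`, `HistoryTailL` is proved here.  YM₃ on T³ is rung R3, not Clay.

References: L. Simon, Theorems on Regularity and Singularity of Energy Minimizing Maps (1996) [Simon1996] (§2.9 Lemma 1);
R. Hardt, D. Kinderlehrer, F.-H. Lin, Comm. Math. Phys. 105 (1986) 547–570 [HardtKinderlehrerLin1986] (§2);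
S. Luckhaus, Indiana Univ. Math. J. 37 (1988) [Luckhaus1988].
-/

set_option autoImplicit false

noncomputable section

open MeasureTheory Set Function Filter Topology Metric TopologicalSpace
open scoped ENNReal BigOperators

namespace Summit.QuantumFields.YangMills.Theorems.PoincareLipschitzMinimisingMapCompactnessMinimality

open Literature.Analysis.FunctionSpaces (HasWeakFDerivOn)
open Summit.QuantumFields.YangMills.Theorems.PoincareLipschitzCompetitorTransfer (competitor_transfer_of_ballMinimiser
  dens_ae_eq_off_ball setIntegral_ball_eq_add_sdiff)
open Summit.QuantumFields.YangMills.Theorems.PoincareLipschitzShellPigeonhole (exists_shell_mul_setIntegral_le)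
open Summit.QuantumFields.YangMills.Theorems.PoincareLipschitzMinimisingMapCompactnessLetters
open Summit.QuantumFields.YangMills.Theorems.PoincareLipschitzMinimisingMapCompactnessEnergy

-- hb: README HEARTBEAT BUDGET ∕ №24 (a): measured FAIL at 100k ∕ PASS at the 200k default (one long bookkeeping proof,
-- cumulative budget; no single step is expensive); explicit headroom, statement and proof untouched — w2 g13 2026-08-29 15:05Z
set_option maxHeartbeats 400000 in
/-- ★★★ **(C-e2) THE LIMIT IS BALL-MINIMISING**, CONDITIONAL on the HKL shell-competitor socket `hHKL` (constant `K`), given the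
class rows of the `u_j`, the rows of the limit `(U, G)`, `L²(Q)` convergence, and ENERGY CONVERGENCE on every ball
`closedBall y ρ ⊆ Q` ((C-e1)'s conclusion, row `hE`). [cite: Simon1996, §2.9 Lemma 1 (proof: the limit minimises)] -/
theorem ballMinimal_limit (hQ : IsOpen {x : EuclideanSpace ℝ (Fin 3) | ∀ i : Fin 3, |x i| < 1}) {K : ℝ} (hK : 0 ≤ K)
    (hHKL : ∀ (u V : EuclideanSpace ℝ (Fin 3) → EuclideanSpace ℝ (Fin 4))
      (Gu GV : EuclideanSpace ℝ (Fin 3) → (EuclideanSpace ℝ (Fin 3) →L[ℝ] EuclideanSpace ℝ (Fin 4))),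
      HasWeakFDerivOn ⟨{x : EuclideanSpace ℝ (Fin 3) | ∀ i : Fin 3, |x i| < 1}, hQ⟩ volume u Gu →
      HasWeakFDerivOn ⟨{x : EuclideanSpace ℝ (Fin 3) | ∀ i : Fin 3, |x i| < 1}, hQ⟩ volume V GV →
      (∀ x : EuclideanSpace ℝ (Fin 3), (∀ i : Fin 3, |x i| < 1) → ‖u x‖ = 1) →
      (∀ x : EuclideanSpace ℝ (Fin 3), (∀ i : Fin 3, |x i| < 1) → ‖V x‖ = 1) →
      IntegrableOn (fun x => ∑ i : Fin 3, ‖Gu x (EuclideanSpace.single i (1:ℝ))‖ ^ 2)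
        {x : EuclideanSpace ℝ (Fin 3) | ∀ i : Fin 3, |x i| < 1} volume →
      IntegrableOn (fun x => ∑ i : Fin 3, ‖GV x (EuclideanSpace.single i (1:ℝ))‖ ^ 2)
        {x : EuclideanSpace ℝ (Fin 3) | ∀ i : Fin 3, |x i| < 1} volume →
      ∀ (y : EuclideanSpace ℝ (Fin 3)) (ρ₁ ρ₂ : ℝ), 0 < ρ₁ → ρ₁ < ρ₂ →
      closedBall y ρ₂ ⊆ {x : EuclideanSpace ℝ (Fin 3) | ∀ i : Fin 3, |x i| < 1} →
      ∃ (W : EuclideanSpace ℝ (Fin 3) → EuclideanSpace ℝ (Fin 4))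
        (GW : EuclideanSpace ℝ (Fin 3) → (EuclideanSpace ℝ (Fin 3) →L[ℝ] EuclideanSpace ℝ (Fin 4))),
        HasWeakFDerivOn ⟨{x : EuclideanSpace ℝ (Fin 3) | ∀ i : Fin 3, |x i| < 1}, hQ⟩ volume W GW ∧
        (∀ x : EuclideanSpace ℝ (Fin 3), (∀ i : Fin 3, |x i| < 1) → ‖W x‖ = 1) ∧
        IntegrableOn (fun x => ∑ i : Fin 3, ‖GW x (EuclideanSpace.single i (1:ℝ))‖ ^ 2)
          {x : EuclideanSpace ℝ (Fin 3) | ∀ i : Fin 3, |x i| < 1} volume ∧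
        (∀ x ∈ ball y ρ₁, W x = V x) ∧ (∀ x, x ∉ ball y ρ₂ → W x = u x) ∧
        ∫ x in ball y ρ₂ \ ball y ρ₁, ∑ i : Fin 3, ‖GW x (EuclideanSpace.single i (1:ℝ))‖ ^ 2 ≤
          K * ((∫ x in ball y ρ₂ \ ball y ρ₁, ∑ i : Fin 3, ‖GV x (EuclideanSpace.single i (1:ℝ))‖ ^ 2) +
            (∫ x in ball y ρ₂ \ ball y ρ₁, ∑ i : Fin 3, ‖Gu x (EuclideanSpace.single i (1:ℝ))‖ ^ 2) +
            (ρ₂ - ρ₁)⁻¹ ^ 2 * ∫ x in ball y ρ₂ \ ball y ρ₁, ‖V x - u x‖ ^ 2))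
    {u : ℕ → EuclideanSpace ℝ (Fin 3) → EuclideanSpace ℝ (Fin 4)}
    {Gs : ℕ → EuclideanSpace ℝ (Fin 3) → (EuclideanSpace ℝ (Fin 3) →L[ℝ] EuclideanSpace ℝ (Fin 4))}
    (hu : ∀ j, HasWeakFDerivOn ⟨{x : EuclideanSpace ℝ (Fin 3) | ∀ i : Fin 3, |x i| < 1}, hQ⟩ volume (u j) (Gs j))
    (hu1 : ∀ j (x : EuclideanSpace ℝ (Fin 3)), (∀ i : Fin 3, |x i| < 1) → ‖u j x‖ = 1)
    (hGi : ∀ j, IntegrableOn (fun x => ∑ i : Fin 3, ‖Gs j x (EuclideanSpace.single i (1:ℝ))‖ ^ 2)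
      {x : EuclideanSpace ℝ (Fin 3) | ∀ i : Fin 3, |x i| < 1} volume)
    (hmin : ∀ (j : ℕ) (y : EuclideanSpace ℝ (Fin 3)) (ρ : ℝ), 0 < ρ →
      closedBall y ρ ⊆ {x : EuclideanSpace ℝ (Fin 3) | ∀ i : Fin 3, |x i| < 1} →
      ∀ (W : EuclideanSpace ℝ (Fin 3) → EuclideanSpace ℝ (Fin 4))
        (GW : EuclideanSpace ℝ (Fin 3) → (EuclideanSpace ℝ (Fin 3) →L[ℝ] EuclideanSpace ℝ (Fin 4))),
      HasWeakFDerivOn ⟨{x : EuclideanSpace ℝ (Fin 3) | ∀ i : Fin 3, |x i| < 1}, hQ⟩ volume W GW →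
      (∀ x : EuclideanSpace ℝ (Fin 3), (∀ i : Fin 3, |x i| < 1) → ‖W x‖ = 1) →
      IntegrableOn (fun x => ∑ i : Fin 3, ‖GW x (EuclideanSpace.single i (1:ℝ))‖ ^ 2)
        {x : EuclideanSpace ℝ (Fin 3) | ∀ i : Fin 3, |x i| < 1} →
      (∃ ρ' : ℝ, ρ' < ρ ∧ ∀ x : EuclideanSpace ℝ (Fin 3), x ∉ ball y ρ' → W x = u j x) →
      ∫ x in ball y ρ, ∑ i : Fin 3, ‖Gs j x (EuclideanSpace.single i (1:ℝ))‖ ^ 2 ≤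
        ∫ x in ball y ρ, ∑ i : Fin 3, ‖GW x (EuclideanSpace.single i (1:ℝ))‖ ^ 2)
    {U : EuclideanSpace ℝ (Fin 3) → EuclideanSpace ℝ (Fin 4)}
    {G : EuclideanSpace ℝ (Fin 3) → (EuclideanSpace ℝ (Fin 3) →L[ℝ] EuclideanSpace ℝ (Fin 4))}
    (hUG : HasWeakFDerivOn ⟨{x : EuclideanSpace ℝ (Fin 3) | ∀ i : Fin 3, |x i| < 1}, hQ⟩ volume U G)
    (hU1 : ∀ x, ‖U x‖ = 1)
    (hGdens : IntegrableOn (fun x => ∑ i : Fin 3, ‖G x (EuclideanSpace.single i (1:ℝ))‖ ^ 2)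
      {x : EuclideanSpace ℝ (Fin 3) | ∀ i : Fin 3, |x i| < 1} volume)
    (hL2 : Tendsto (fun j => ∫ x in {x : EuclideanSpace ℝ (Fin 3) | ∀ i : Fin 3, |x i| < 1}, ‖u j x - U x‖ ^ 2)
      atTop (𝓝 0))
    (hE : ∀ (y : EuclideanSpace ℝ (Fin 3)) (ρ : ℝ), 0 < ρ →
      closedBall y ρ ⊆ {x : EuclideanSpace ℝ (Fin 3) | ∀ i : Fin 3, |x i| < 1} →
      Tendsto (fun j => ∫ x in ball y ρ, ∑ i : Fin 3, ‖Gs j x (EuclideanSpace.single i (1:ℝ))‖ ^ 2) atTop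
        (𝓝 (∫ x in ball y ρ, ∑ i : Fin 3, ‖G x (EuclideanSpace.single i (1:ℝ))‖ ^ 2)))
    {y : EuclideanSpace ℝ (Fin 3)} {ρ : ℝ} (hρ : 0 < ρ)
    (hρQ : closedBall y ρ ⊆ {x : EuclideanSpace ℝ (Fin 3) | ∀ i : Fin 3, |x i| < 1})
    {W : EuclideanSpace ℝ (Fin 3) → EuclideanSpace ℝ (Fin 4)}
    {GW : EuclideanSpace ℝ (Fin 3) → (EuclideanSpace ℝ (Fin 3) →L[ℝ] EuclideanSpace ℝ (Fin 4))}
    (hWd : HasWeakFDerivOn ⟨{x : EuclideanSpace ℝ (Fin 3) | ∀ i : Fin 3, |x i| < 1}, hQ⟩ volume W GW)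
    (hW1 : ∀ x : EuclideanSpace ℝ (Fin 3), (∀ i : Fin 3, |x i| < 1) → ‖W x‖ = 1)
    (hWi : IntegrableOn (fun x => ∑ i : Fin 3, ‖GW x (EuclideanSpace.single i (1:ℝ))‖ ^ 2)
      {x : EuclideanSpace ℝ (Fin 3) | ∀ i : Fin 3, |x i| < 1} volume)
    {ρ' : ℝ} (hρ'ρ : ρ' < ρ) (hWU : ∀ x : EuclideanSpace ℝ (Fin 3), x ∉ ball y ρ' → W x = U x) :
    ∫ x in ball y ρ, ∑ i : Fin 3, ‖G x (EuclideanSpace.single i (1:ℝ))‖ ^ 2 ≤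
      ∫ x in ball y ρ, ∑ i : Fin 3, ‖GW x (EuclideanSpace.single i (1:ℝ))‖ ^ 2 := by
  set Q : Set (EuclideanSpace ℝ (Fin 3)) := {x | ∀ i : Fin 3, |x i| < 1} with hQdef
  have hQm : MeasurableSet Q := hQ.measurableSet
  have hU1' : ∀ x : EuclideanSpace ℝ (Fin 3), (∀ i : Fin 3, |x i| < 1) → ‖U x‖ = 1 := fun x _ => hU1 x
  -- radii: `ρ' ≤ ρ₀ < σ < ρ < t'`
  set ρ₀ : ℝ := max ρ' (ρ / 2) with hρ₀
  have hρ₀ρ : ρ₀ < ρ := max_lt hρ'ρ (by linarith)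
  have hρ₀0 : 0 < ρ₀ := lt_of_lt_of_le (by linarith) (le_max_right _ _)
  have hWU₀ : ∀ x : EuclideanSpace ℝ (Fin 3), x ∉ ball y ρ₀ → W x = U x :=
    fun x hx => hWU x fun h => hx (ball_subset_ball (le_max_left _ _) h)
  set σ : ℝ := (ρ₀ + ρ) / 2 with hσ
  have hρ₀σ : ρ₀ < σ := by rw [hσ]; linarith
  have hσρ : σ < ρ := by rw [hσ]; linarith
  obtain ⟨δ, hδ, hδQ⟩ := exists_margin hQ hρ.le hρQ
  set t' : ℝ := ρ + δ / 2 with ht'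
  have hρt' : ρ < t' := by rw [ht']; linarith
  have ht'0 : 0 < t' := lt_trans hρ hρt'
  have ht'Q : closedBall y t' ⊆ Q := (closedBall_subset_closedBall (by rw [ht']; linarith)).trans hδQ
  have hballQ : ball y ρ ⊆ Q := ball_subset_closedBall.trans hρQ
  -- locality: `dens GW = dens G` a.e. on `Q ∖ ball y ρ₀`
  have hloc := dens_ae_eq_off_ball (Ω := ⟨Q, hQ⟩) hUG hWd (y := y) (ρ₂ := ρ₀) fun x hx hxb => hWU₀ x hxb
  have hloc_int : ∀ S : Set (EuclideanSpace ℝ (Fin 3)), S ⊆ Q \ ball y ρ₀ →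
      ∫ x in S, ∑ i : Fin 3, ‖GW x (EuclideanSpace.single i (1:ℝ))‖ ^ 2 =
        ∫ x in S, ∑ i : Fin 3, ‖G x (EuclideanSpace.single i (1:ℝ))‖ ^ 2 :=
    fun S hS => integral_congr_ae (ae_restrict_of_ae_restrict_of_subset hS hloc)
  -- the total energy of `U`
  set EU : ℝ := ∫ x in Q, ∑ i : Fin 3, ‖G x (EuclideanSpace.single i (1:ℝ))‖ ^ 2 with hEU
  have hEU0 : 0 ≤ EU := setIntegral_nonneg hQm fun x _ => dens_nonneg (G x)
  refine le_of_forall_pos_le_add fun ε hε => ?_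
  -- the number of shells `N`
  obtain ⟨N, hNpos, hN⟩ : ∃ N : ℕ, 0 < N ∧ 2 * K * EU / N ≤ ε := by
    obtain ⟨N, hN⟩ := exists_nat_gt (2 * K * EU / ε)
    have hNpos : 0 < N := by
      have : (0 : ℝ) < N := lt_of_le_of_lt (by positivity) hN
      exact_mod_cast this
    refine ⟨N, hNpos, ?_⟩
    have hN' : (0 : ℝ) < N := by exact_mod_cast hNpos
    rw [div_le_iff₀ hN']
    have := (div_lt_iff₀ hε).1 hN
    linarith
  have hNr : (0 : ℝ) < N := by exact_mod_cast hNpos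
  set h : ℝ := (ρ - σ) / N with hh
  have hh0 : 0 < h := div_pos (by linarith) hNr
  have hNh : (N : ℝ) * h = ρ - σ := by rw [hh]; field_simp
  -- pigeonhole on `U`'s energy over the shells in `(σ, ρ)`
  have hreg : {x : EuclideanSpace ℝ (Fin 3) | σ ≤ dist x y ∧ dist x y < σ + N * h} ⊆ Q := by
    rw [shell_eq_sdiff, hNh, add_sub_cancel]; exact sdiff_subset.trans hballQ
  obtain ⟨i, hiN, hi⟩ := exists_shell_mul_setIntegral_le volume y σ hh0 hNpos (hGdens.mono_set hreg)
  set ρ₁ : ℝ := σ + i * h with hρ₁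
  set ρ₂ : ℝ := σ + (i + 1) * h with hρ₂
  have hi0 : (0 : ℝ) ≤ i := by exact_mod_cast Nat.zero_le i
  have hiN' : (i : ℝ) + 1 ≤ N := by exact_mod_cast hiN
  have hσρ₁ : σ ≤ ρ₁ := by rw [hρ₁]; nlinarith
  have h12 : ρ₁ < ρ₂ := by rw [hρ₁, hρ₂]; nlinarith
  have h21 : ρ₂ - ρ₁ = h := by rw [hρ₁, hρ₂]; ring
  have hρ₂ρ : ρ₂ ≤ ρ := by
    rw [hρ₂]
    have : ((i : ℝ) + 1) * h ≤ N * h := mul_le_mul_of_nonneg_right hiN' hh0.le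
    linarith
  have hρ₁0 : 0 < ρ₁ := lt_of_lt_of_le (lt_trans hρ₀0 hρ₀σ) hσρ₁
  have hρ₁Q : closedBall y ρ₁ ⊆ Q := (closedBall_subset_closedBall (h12.le.trans hρ₂ρ)).trans hρQ
  have hρ₂Q : closedBall y ρ₂ ⊆ Q := (closedBall_subset_closedBall hρ₂ρ).trans hρQ
  have hshell : {x : EuclideanSpace ℝ (Fin 3) | σ + i * h ≤ dist x y ∧ dist x y < σ + (i + 1) * h} =
      ball y ρ₂ \ ball y ρ₁ := shell_eq_sdiff y _ _
  have hshell₀ : ball y ρ₂ \ ball y ρ₁ ⊆ Q \ ball y ρ₀ := fun x hx =>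
    ⟨hballQ (ball_subset_ball hρ₂ρ hx.1), fun hb => hx.2 (ball_subset_ball (hρ₀σ.le.trans hσρ₁) hb)⟩
  have houter₀ : ball y ρ \ ball y ρ₂ ⊆ Q \ ball y ρ₀ := fun x hx =>
    ⟨hballQ hx.1, fun hb => hx.2 (ball_subset_ball ((hρ₀σ.le.trans hσρ₁).trans h12.le) hb)⟩
  have hshellQ : ball y ρ₂ \ ball y ρ₁ ⊆ Q := fun x hx => (hshell₀ hx).1
  have hsmall : ∫ x in ball y ρ₂ \ ball y ρ₁, ∑ i : Fin 3, ‖G x (EuclideanSpace.single i (1:ℝ))‖ ^ 2 ≤ EU / N := by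
    rw [hshell] at hi
    rw [le_div_iff₀ hNr, mul_comm]
    exact hi.trans (energy_mono hreg hGdens)
  -- the per-`j` inequality from the socket (inner map `W`) and D1
  have hab : ∀ j, ∫ x in ball y ρ₂, ∑ i : Fin 3, ‖Gs j x (EuclideanSpace.single i (1:ℝ))‖ ^ 2 ≤
      (∫ x in ball y ρ₁, ∑ i : Fin 3, ‖GW x (EuclideanSpace.single i (1:ℝ))‖ ^ 2) +
        K * ((∫ x in ball y ρ₂ \ ball y ρ₁, ∑ i : Fin 3, ‖G x (EuclideanSpace.single i (1:ℝ))‖ ^ 2) +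
          ((∫ x in ball y ρ₂, ∑ i : Fin 3, ‖Gs j x (EuclideanSpace.single i (1:ℝ))‖ ^ 2) -
            ∫ x in ball y ρ₁, ∑ i : Fin 3, ‖Gs j x (EuclideanSpace.single i (1:ℝ))‖ ^ 2) +
          h⁻¹ ^ 2 * ∫ x in Q, ‖u j x - U x‖ ^ 2) := by
    intro j
    obtain ⟨Wj, GWj, hWjd, hWj1, hWji, hWjin, hWjout, hWjsh⟩ :=
      hHKL (u j) W (Gs j) GW (hu j) hWd (hu1 j) hW1 (hGi j) hWi y ρ₁ ρ₂ hρ₁0 h12 hρ₂Q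
    have hD1 := competitor_transfer_of_ballMinimiser hQ (hu j) (hGi j) ht'Q (hmin j y t' ht'0 ht'Q) hWd hWjd hWj1 hWji
      h12.le (lt_of_le_of_lt hρ₂ρ hρt') hWjin hWjout
    -- rewrite the three shell terms
    have hWsh : ∫ x in ball y ρ₂ \ ball y ρ₁, ∑ i : Fin 3, ‖GW x (EuclideanSpace.single i (1:ℝ))‖ ^ 2 =
        ∫ x in ball y ρ₂ \ ball y ρ₁, ∑ i : Fin 3, ‖G x (EuclideanSpace.single i (1:ℝ))‖ ^ 2 := hloc_int _ hshell₀
    have hush : ∫ x in ball y ρ₂ \ ball y ρ₁, ∑ i : Fin 3, ‖Gs j x (EuclideanSpace.single i (1:ℝ))‖ ^ 2 =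
        (∫ x in ball y ρ₂, ∑ i : Fin 3, ‖Gs j x (EuclideanSpace.single i (1:ℝ))‖ ^ 2) -
          ∫ x in ball y ρ₁, ∑ i : Fin 3, ‖Gs j x (EuclideanSpace.single i (1:ℝ))‖ ^ 2 := by
      rw [setIntegral_ball_eq_add_sdiff h12.le ((hGi j).mono_set (ball_subset_closedBall.trans hρ₂Q))]
      ring
    have hL2sh : ∫ x in ball y ρ₂ \ ball y ρ₁, ‖W x - u j x‖ ^ 2 ≤ ∫ x in Q, ‖u j x - U x‖ ^ 2 := by
      have hint : IntegrableOn (fun x => ‖u j x - U x‖ ^ 2) Q volume := by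
        haveI : IsFiniteMeasure (volume.restrict Q) := isFiniteMeasure_restrict.2
          (Summit.QuantumFields.YangMills.Theorems.PoincareLipschitzDyadicMeansWeakLimit.volume_openCube_lt_top).ne
        refine Summit.QuantumFields.YangMills.Theorems.PoincareLipschitzBlowDownWeakGradientLetters.integrable_of_norm_le
          (((hu j).locallyIntegrableOn.aestronglyMeasurable.sub
            hUG.locallyIntegrableOn.aestronglyMeasurable).norm.pow 2) 4 ?_
        filter_upwards [ae_restrict_mem hQm] with x hx
        rw [Real.norm_eq_abs, abs_of_nonneg (sq_nonneg _)]
        have h1 : ‖u j x - U x‖ ≤ 2 := by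
          calc ‖u j x - U x‖ ≤ ‖u j x‖ + ‖U x‖ := norm_sub_le _ _
            _ = 2 := by rw [hu1 j x hx, hU1 x]; norm_num
        nlinarith [norm_nonneg (u j x - U x)]
      have heqsh : ∀ x ∈ ball y ρ₂ \ ball y ρ₁, ‖W x - u j x‖ ^ 2 = ‖u j x - U x‖ ^ 2 := fun x hx => by
        rw [hWU₀ x (hshell₀ hx).2, norm_sub_rev]
      rw [setIntegral_congr_fun (measurableSet_ball.diff measurableSet_ball) heqsh]
      exact setIntegral_mono_set hint (Eventually.of_forall fun x => sq_nonneg _) hshellQ.eventuallyLE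
    rw [hWsh, hush, h21] at hWjsh
    have e2 : h⁻¹ ^ 2 * ∫ x in ball y ρ₂ \ ball y ρ₁, ‖W x - u j x‖ ^ 2 ≤ h⁻¹ ^ 2 * ∫ x in Q, ‖u j x - U x‖ ^ 2 :=
      mul_le_mul_of_nonneg_left hL2sh (by positivity)
    have e3 := mul_le_mul_of_nonneg_left (add_le_add_left e2
      ((∫ x in ball y ρ₂ \ ball y ρ₁, ∑ i : Fin 3, ‖G x (EuclideanSpace.single i (1:ℝ))‖ ^ 2) +
        ((∫ x in ball y ρ₂, ∑ i : Fin 3, ‖Gs j x (EuclideanSpace.single i (1:ℝ))‖ ^ 2) -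
          ∫ x in ball y ρ₁, ∑ i : Fin 3, ‖Gs j x (EuclideanSpace.single i (1:ℝ))‖ ^ 2))) hK
    linarith [hD1, hWjsh, e3]
  -- pass to the limit `j → ∞`
  have hlim : ∫ x in ball y ρ₂, ∑ i : Fin 3, ‖G x (EuclideanSpace.single i (1:ℝ))‖ ^ 2 ≤
      (∫ x in ball y ρ₁, ∑ i : Fin 3, ‖GW x (EuclideanSpace.single i (1:ℝ))‖ ^ 2) +
        K * ((∫ x in ball y ρ₂ \ ball y ρ₁, ∑ i : Fin 3, ‖G x (EuclideanSpace.single i (1:ℝ))‖ ^ 2) +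
          ((∫ x in ball y ρ₂, ∑ i : Fin 3, ‖G x (EuclideanSpace.single i (1:ℝ))‖ ^ 2) -
            ∫ x in ball y ρ₁, ∑ i : Fin 3, ‖G x (EuclideanSpace.single i (1:ℝ))‖ ^ 2) +
          h⁻¹ ^ 2 * 0) :=
    by
    have hE₂ := hE y ρ₂ (lt_trans hρ₁0 h12) hρ₂Q
    have hE₁ := hE y ρ₁ hρ₁0 hρ₁Q
    have hb : Tendsto (fun j => (∫ x in ball y ρ₁, ∑ i : Fin 3, ‖GW x (EuclideanSpace.single i (1:ℝ))‖ ^ 2) +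
        K * ((∫ x in ball y ρ₂ \ ball y ρ₁, ∑ i : Fin 3, ‖G x (EuclideanSpace.single i (1:ℝ))‖ ^ 2) +
          ((∫ x in ball y ρ₂, ∑ i : Fin 3, ‖Gs j x (EuclideanSpace.single i (1:ℝ))‖ ^ 2) -
            ∫ x in ball y ρ₁, ∑ i : Fin 3, ‖Gs j x (EuclideanSpace.single i (1:ℝ))‖ ^ 2) +
          h⁻¹ ^ 2 * ∫ x in Q, ‖u j x - U x‖ ^ 2)) atTop
        (𝓝 ((∫ x in ball y ρ₁, ∑ i : Fin 3, ‖GW x (EuclideanSpace.single i (1:ℝ))‖ ^ 2) +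
          K * ((∫ x in ball y ρ₂ \ ball y ρ₁, ∑ i : Fin 3, ‖G x (EuclideanSpace.single i (1:ℝ))‖ ^ 2) +
            ((∫ x in ball y ρ₂, ∑ i : Fin 3, ‖G x (EuclideanSpace.single i (1:ℝ))‖ ^ 2) -
              ∫ x in ball y ρ₁, ∑ i : Fin 3, ‖G x (EuclideanSpace.single i (1:ℝ))‖ ^ 2) +
            h⁻¹ ^ 2 * 0))) :=
      tendsto_const_nhds.add (((tendsto_const_nhds.add (hE₂.sub hE₁)).add (hL2.const_mul (h⁻¹ ^ 2))).const_mul K)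
    exact le_of_tendsto_of_tendsto' hE₂ hb hab
  -- assemble on `ball y ρ`
  have hUsplit := setIntegral_ball_eq_add_sdiff hρ₂ρ (hGdens.mono_set hballQ)
  have hWsplit := setIntegral_ball_eq_add_sdiff hρ₂ρ (hWi.mono_set hballQ)
  have hUsh : ∫ x in ball y ρ₂ \ ball y ρ₁, ∑ i : Fin 3, ‖G x (EuclideanSpace.single i (1:ℝ))‖ ^ 2 =
      (∫ x in ball y ρ₂, ∑ i : Fin 3, ‖G x (EuclideanSpace.single i (1:ℝ))‖ ^ 2) -
        ∫ x in ball y ρ₁, ∑ i : Fin 3, ‖G x (EuclideanSpace.single i (1:ℝ))‖ ^ 2 := by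
    rw [setIntegral_ball_eq_add_sdiff h12.le (hGdens.mono_set (ball_subset_closedBall.trans hρ₂Q))]
    ring
  have houter : ∫ x in ball y ρ \ ball y ρ₂, ∑ i : Fin 3, ‖G x (EuclideanSpace.single i (1:ℝ))‖ ^ 2 =
      ∫ x in ball y ρ \ ball y ρ₂, ∑ i : Fin 3, ‖GW x (EuclideanSpace.single i (1:ℝ))‖ ^ 2 := (hloc_int _ houter₀).symm
  have hWmono : ∫ x in ball y ρ₁, ∑ i : Fin 3, ‖GW x (EuclideanSpace.single i (1:ℝ))‖ ^ 2 ≤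
      ∫ x in ball y ρ₂, ∑ i : Fin 3, ‖GW x (EuclideanSpace.single i (1:ℝ))‖ ^ 2 :=
    energy_mono (ball_subset_ball h12.le) (hWi.mono_set (ball_subset_closedBall.trans hρ₂Q))
  have e5 := mul_le_mul_of_nonneg_left hsmall hK
  have e6 : K * ((∫ x in ball y ρ₂ \ ball y ρ₁, ∑ i : Fin 3, ‖G x (EuclideanSpace.single i (1:ℝ))‖ ^ 2) +
      ((∫ x in ball y ρ₂, ∑ i : Fin 3, ‖G x (EuclideanSpace.single i (1:ℝ))‖ ^ 2) -
        ∫ x in ball y ρ₁, ∑ i : Fin 3, ‖G x (EuclideanSpace.single i (1:ℝ))‖ ^ 2) + h⁻¹ ^ 2 * 0) =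
      2 * (K * ∫ x in ball y ρ₂ \ ball y ρ₁, ∑ i : Fin 3, ‖G x (EuclideanSpace.single i (1:ℝ))‖ ^ 2) := by
    rw [← hUsh]; ring
  have e7 : 2 * K * EU / N = 2 * (K * (EU / N)) := by ring
  rw [hUsplit, hWsplit, houter]
  linarith [hlim, hWmono, e5, hN, e6, e7]

end Summit.QuantumFields.YangMills.Theorems.PoincareLipschitzMinimisingMapCompactnessMinimality

end
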